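import Literature.Probability.LatticeModels.DartPhase
import Literature.Probability.LatticeModels.DirichletGreenFunction
import Literature.Probability.RandomPlanarGeometry.PlanarDomains
import Summits.CriticalPhenomena.CardyFormulaZ2.Theorems.CardySusyWardParafermionPrecompactKenyonDefs
import Summits.CriticalPhenomena.CardyFormulaZ2.Theorems.CardySusyWardParafermionPrecompactPairIdentityCore
import Summits.CriticalPhenomena.CardyFormulaZ2.Theorems.CardySusyWardParafermionPrecompactExcisedLoopOrientation

/-!
# The pointwise pair identity at spin `1/3`, II: the identity (helper for stub `stub_vertexRelation`)

Line `kenyon-stream-second-relation` of the crux `ParafermionPrecompact` (route `CardySusyWard`,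
item stmt-CriticalPhenomena-11293); continuation of `…PairIdentityCore.lean` (notation `𝓊 = e^{iπ/6}`,
`dsum[β, c₀, N, r]`). For an admissible datum with Jordan carrier, an interior edge `e = cTgt p`
(all faces at both endpoints inner, no endpoint on the arc `B`) and two configurations `ω`, `ω'`
whose completions agree off `e` and differ at `e`, the spin-`1/3` vertex combinations
`rel = dsum p - dsum p₂ - i (dsum p⁺ - dsum p₂⁺)` of the four dart sums at `e` of the two
explorations cancel: **`rel(ω) + rel(ω') = 0`** (`pair_rel_add_eq_zero`, registered helper; the
statement is spelt out without notation). This is the per-pair identity behind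
Duminil-Copin–Smirnov 2012, Prop. 8.6 at `q = 1` (the involution `ω ↦ ω ∆ {e}` is applied in
`…VertexRelation.lean`).

* `pair_core`: both darts of `e` on the path of `ω`, `p` first. By `excisedLoop_turnSign_sum` the
  excised loop turns by `-4` when it follows `e` (`C₂ = C - 2`, `Δ_ω = a(1 - 𝓊²)`, `Δ_ω' = a`) and
  by `+4` when it crosses it (`C₂ = C + 2`, `Δ_ω = a(1 - 𝓊⁻²)`, `Δ_ω' = a`); then
  `(1 - i𝓊⁻¹)(1 - 𝓊²) + (1 + i𝓊) = 2(𝓊⁴ - 𝓊² + 1) = 0 = (1 + i𝓊)(1 - 𝓊⁻²) + (1 - i𝓊⁻¹)` by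
  `i = 𝓊³`, `𝓊⁶ = -1` (`linear_combination`).
* `pair_of_arrives`: `p` on the path of `ω`; the partner also (core case in the order of arrival,
  `rel_partner`) or not — then (`cornerOrbit_toggle_case1`) the partner's loop is spliced into the
  toggled exploration, which is the core case read from `ω'`.
* `pair_rel_add_eq_zero`: remaining case, no dart of `ω` at `e` — then none of `ω'` either
  (`cornerOrbit_toggle_case0`) and both combinations vanish (`rel_eq`).

References: H. Duminil-Copin, S. Smirnov, Clay Math. Proc. 15 (2012), §8.3 Prop. 8.6
[DuminilCopinSmirnov2012Lattice]; S. Smirnov, Ann. of Math. 172 (2010), proof of Lemma 4.5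
[Smirnov2010].
-/

noncomputable section

namespace Summit.CriticalPhenomena.CardyFormulaZ2.Cruxes.ParafermionPrecompact.KenyonStreamSecondRelation

open Finset
open _root_.Literature.Probability.LatticeModels
open _root_.Literature.Probability.Percolation (BondConfig)
open _root_.Literature.Probability.RandomPlanarGeometry (DobrushinDomain)

section PairCoreCase

open Complex

local notation "𝓊" => Complex.exp (((Real.pi / 6 : ℝ) : ℂ) * Complex.I)

local notation "dsum[" β₀ ", " c ", " N ", " r "]" =>
  ∑ j ∈ Finset.filter (fun j => cornerOrbit β₀ c j = r) (Finset.range N), 𝓊 ^ (-(turnCount β₀ c j))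

variable {E : DiscreteDobrushin} {ω ω' : BondConfig (Site 2)} {c₀ p : Site 2 × Fin 4}

local notation "β" => E.bcBondConfig ω
local notation "β'" => E.bcBondConfig ω'
local notation "orb" => cornerOrbit (E.bcBondConfig ω) c₀
local notation "orb'" => cornerOrbit (E.bcBondConfig ω') c₀

/-- **The pair identity, core case** (both darts of `e` on the path of `ω`, `p` first; Jordan
carrier for the orientation of the excised loop): the spin-`1/3` vertex residuals of `ω` and of
the toggled `ω'` cancel. The excised loop turns by `-4` when it follows `e` (then
`C₂ = C - 2`, `Δ_ω = a(1 - 𝓊²)`, `Δ_ω' = a`) and by `+4` when it crosses it (`C₂ = C + 2`,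
`Δ_ω = a(1 - 𝓊⁻²)`, `Δ_ω' = a`), and `(1 - i𝓊⁻¹)(1 - 𝓊²) + (1 + i𝓊) = 2(𝓊⁴ - 𝓊² + 1) = 0 =
(1 + i𝓊)(1 - 𝓊⁻²) + (1 - i𝓊⁻¹)` by `i = 𝓊³`, `𝓊⁶ = -1`.
[cite: DuminilCopinSmirnov2012Lattice, §8.3 Prop. 8.6] -/
theorem pair_core (D : DobrushinDomain) (hΩ : E.Ω = D.carrier) (hE : E.IsZdAdmissible) (hc₀ : E.IsStartCorner c₀)
    (hagree : ∀ e, e ≠ cTgt p → (e ∈ β' ↔ e ∈ β)) (hdiff : ¬ (cTgt p ∈ β' ↔ cTgt p ∈ β))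
    (hB : ∀ x ∈ cTgt p, x ∉ E.zdArcB) {N N' i₁ i₂ : ℕ}
    (hN : ¬ E.IsInnerFace (cFace (orb N))) (hlt : ∀ k < N, E.IsInnerFace (cFace (orb k)))
    (hN' : ¬ E.IsInnerFace (cFace (orb' N'))) (hlt' : ∀ k < N', E.IsInnerFace (cFace (orb' k)))
    (hi₁ : orb i₁ = p) (hi₂ : orb i₂ = cornerPartner p) (h12 : i₁ < i₂) (hi₂N : i₂ < N) :
    (dsum[β, c₀, N, p] - dsum[β, c₀, N, cornerPartner p] -
        I * (dsum[β, c₀, N, (p.1, p.2 + 1)] - dsum[β, c₀, N, ((cornerPartner p).1, (cornerPartner p).2 + 1)])) +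
      (dsum[β', c₀, N', p] - dsum[β', c₀, N', cornerPartner p] -
        I * (dsum[β', c₀, N', (p.1, p.2 + 1)] - dsum[β', c₀, N', ((cornerPartner p).1, (cornerPartner p).2 + 1)])) = 0 := by
  -- the toggled exit time
  obtain ⟨hexN, hexlt⟩ := exit_toggle_case2 hE hc₀ hagree hdiff hN hlt hi₁ hi₂ h12 hi₂N
  obtain rfl : N' = N - (i₂ - i₁) := exitIndex_unique E _ _ _ _ hN' hlt' hexN hexlt
  obtain ⟨d1, d2, d1', d2', hS⟩ := dsum_case2 hE hc₀ hagree hdiff hlt hi₁ hi₂ h12 hi₂N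
  obtain ⟨hor1, hor2⟩ := excisedLoop_turnSign_sum D E hΩ hE ω ω' c₀ p hc₀ hagree hdiff N i₁ i₂ hlt hi₁ hi₂ h12 hi₂N
  obtain ⟨r1, r2⟩ := rel_eq (p := p) hE hc₀ hN hlt hB
  obtain ⟨r1', r2'⟩ := rel_eq (p := p) (ω := ω') hE hc₀ hN' hlt' hB
  have h3 := twelfth_pow_three
  have h6 := twelfth_pow_six
  have h4 := twelfth_pow_four_sub
  have hinv : 𝓊⁻¹ = -𝓊 ^ 5 := inv_eq_of_mul_eq_one_right (by linear_combination (-1 : ℂ) * h6)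
  set a := 𝓊 ^ (-turnCount β c₀ i₁) with ha
  by_cases he' : cTgt p ∈ β'
  · -- `e` closed in `ω`, open in `ω'`: the excised loop follows `e`, turn sum `-4`
    have he : cTgt p ∉ β := fun h => hdiff ⟨fun _ => h, fun _ => he'⟩
    have hT := hor1 he'
    rw [hS, turnSign_of_mem (show cTgt (cornerPartner p) ∈ β' by rwa [cTgt_partner])] at hT
    have hSv : ∑ m ∈ Finset.range (i₂ - i₁ - 1), turnSign β (orb (i₁ + 1 + m)) = -3 := by omega
    rw [r1 he, r2' he', d1, d2, d1', d2', turnSign_of_not_mem he, hSv,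
      show turnCount β c₀ i₁ + 1 + -3 = turnCount β c₀ i₁ - 2 by ring, (twelfth_zpow_neg_add_two _).2, ← ha, hinv]
    linear_combination (-(a * (𝓊 ^ 5 - 𝓊 ^ 7 + 𝓊))) * h3 + (a * (𝓊 ^ 2 - 𝓊 ^ 4)) * h6 + (2 * a) * h4
  · -- `e` open in `ω`, closed in `ω'`: the excised loop crosses `e`, turn sum `+4`
    have he : cTgt p ∈ β := by
      by_contra h; exact hdiff ⟨fun h' => absurd h' he', fun h' => absurd h' h⟩
    have hT := hor2 he'
    rw [hS, turnSign_of_not_mem (show cTgt (cornerPartner p) ∉ β' by rwa [cTgt_partner])] at hT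
    have hSv : ∑ m ∈ Finset.range (i₂ - i₁ - 1), turnSign β (orb (i₁ + 1 + m)) = 3 := by omega
    rw [r2 he, r1' he', d1, d2, d1', d2', turnSign_of_mem he, hSv,
      show turnCount β c₀ i₁ + -1 + 3 = turnCount β c₀ i₁ + 2 by ring, (twelfth_zpow_neg_add_two _).1, ← ha, hinv]
    have hsq : (𝓊 ^ 2)⁻¹ = -𝓊 ^ 4 := inv_eq_of_mul_eq_one_right (by linear_combination (-1 : ℂ) * h6)
    rw [hsq]
    linear_combination (-(a * (𝓊 + 2 * 𝓊 ^ 5))) * h3 + (2 * a * 𝓊 ^ 2) * h6 + (2 * a) * h4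

end PairCoreCase

/-! ## The pair identity in all cases -/

section PairWrap

open Complex

local notation "𝓊" => Complex.exp (((Real.pi / 6 : ℝ) : ℂ) * Complex.I)

local notation "dsum[" β₀ ", " c ", " N ", " r "]" =>
  ∑ j ∈ Finset.filter (fun j => cornerOrbit β₀ c j = r) (Finset.range N), 𝓊 ^ (-(turnCount β₀ c j))

/-- The spin-`1/3` vertex combination of the four dart sums at `e = cTgt p` for one configuration:
`dsum p - dsum p₂ - i (dsum p⁺ - dsum p₂⁺)` (`p₂` the partner, `q⁺ = (q.1, q.2 + 1)`). -/
local notation "rel[" β₀ ", " c ", " N ", " p "]" =>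
  dsum[β₀, c, N, p] - dsum[β₀, c, N, cornerPartner p] -
    Complex.I * (dsum[β₀, c, N, (Prod.fst p, Prod.snd p + 1)] -
      dsum[β₀, c, N, (Prod.fst (cornerPartner p), Prod.snd (cornerPartner p) + 1)])

variable {E : DiscreteDobrushin} {ω ω' : BondConfig (Site 2)} {c₀ p : Site 2 × Fin 4}

local notation "β" => E.bcBondConfig ω
local notation "β'" => E.bcBondConfig ω'
local notation "orb" => cornerOrbit (E.bcBondConfig ω) c₀
local notation "orb'" => cornerOrbit (E.bcBondConfig ω') c₀

/-- The combination is antisymmetric in the two corners arriving at `e`. [folklore] -/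
theorem rel_partner (β₀ : BondConfig (Site 2)) (c : Site 2 × Fin 4) (N : ℕ) (p₀ : Site 2 × Fin 4) :
    rel[β₀, c, N, cornerPartner p₀] = -rel[β₀, c, N, p₀] := by
  rw [partner_partner]; ring

/-- The other endpoint of `e`, seen from the partner, is the vertex of `p`. [folklore] -/
theorem partner_fst_add (p₀ : Site 2 × Fin 4) :
    (cornerPartner p₀).1 + cornerUnit ((cornerPartner p₀).2 + 1) = p₀.1 := by
  change p₀.1 + cornerUnit (p₀.2 + 1) + cornerUnit (p₀.2 + 2 + 1) = p₀.1
  rw [fin4_add_two_add_one, show p₀.2 + 3 = (p₀.2 + 1) + 2 from (fin4_add_one_add_two p₀.2).symm,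
    cornerUnit_add_two]
  abel

/-- **The pair identity when `p` is a dart of the exploration of `ω`.** Either the partner is
also a dart of `ω` (core case, in the order of arrival, through `rel_partner` if the partner comes
first), or it is not: then (`cornerOrbit_toggle_case1`) the partner's loop is spliced into the
toggled exploration, which arrives through `p` and then through the partner — the core case for
the pair read from `ω'`. [cite: DuminilCopinSmirnov2012Lattice, §8.3 Prop. 8.6] -/
theorem pair_of_arrives (D : DobrushinDomain) (hΩ : E.Ω = D.carrier) (hE : E.IsZdAdmissible) (hc₀ : E.IsStartCorner c₀)
    (hagree : ∀ e, e ≠ cTgt p → (e ∈ β' ↔ e ∈ β)) (hdiff : ¬ (cTgt p ∈ β' ↔ cTgt p ∈ β))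
    (hB : ∀ x ∈ cTgt p, x ∉ E.zdArcB)
    (hx : ∀ j, E.IsInnerFace (faceAt p.1 j)) (hy : ∀ j, E.IsInnerFace (faceAt (p.1 + cornerUnit (p.2 + 1)) j))
    {N N' i₁ : ℕ}
    (hN : ¬ E.IsInnerFace (cFace (orb N))) (hlt : ∀ k < N, E.IsInnerFace (cFace (orb k)))
    (hN' : ¬ E.IsInnerFace (cFace (orb' N'))) (hlt' : ∀ k < N', E.IsInnerFace (cFace (orb' k)))
    (hi₁ : orb i₁ = p) (hi₁N : i₁ < N) :
    rel[β, c₀, N, p] + rel[β', c₀, N', p] = 0 := by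
  have hagree2 : ∀ e, e ≠ cTgt (cornerPartner p) → (e ∈ β' ↔ e ∈ β) := by rw [cTgt_partner]; exact hagree
  have hdiff2 : ¬ (cTgt (cornerPartner p) ∈ β' ↔ cTgt (cornerPartner p) ∈ β) := by rw [cTgt_partner]; exact hdiff
  have hB2 : ∀ x ∈ cTgt (cornerPartner p), x ∉ E.zdArcB := by rw [cTgt_partner]; exact hB
  by_cases h₂ : ∃ i₂, i₂ < N ∧ orb i₂ = cornerPartner p
  · obtain ⟨i₂, hi₂N, hi₂⟩ := h₂
    have hne : i₁ ≠ i₂ := by rintro rfl; exact partner_ne p (hi₂.symm.trans hi₁)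
    rcases Nat.lt_or_gt_of_ne hne with h12 | h12
    · exact pair_core D hΩ hE hc₀ hagree hdiff hB hN hlt hN' hlt' hi₁ hi₂ h12 hi₂N
    · have := pair_core (p := cornerPartner p) D hΩ hE hc₀ hagree2 hdiff2 hB2 hN hlt hN' hlt' hi₂
        (by rw [partner_partner]; exact hi₁) h12 hi₁N
      rw [rel_partner, rel_partner] at this
      linear_combination -this
  · -- the partner never arrives in `ω`: it arrives (after `p`) in `ω'`
    have h₂' : ∀ i < N, orb i ≠ cornerPartner p := fun i hi h => h₂ ⟨i, hi, h⟩
    have hc₀m : c₀.1 ∈ meshDomain E.Ω E.δ :=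
      E.zdBoundary_subset_meshDomain (E.zdArcA_subset_zdBoundary hc₀.mem_zdArcA)
    obtain ⟨P, hP0, hP, hPmin⟩ := exists_min_period hE ω hc₀m
    have hym : (cornerPartner p).1 ∈ meshDomain E.Ω E.δ :=
      mem_meshDomain_of_isCorner_of_isInnerFace (isCorner_faceAt _ 0) (hy 0)
    obtain ⟨Q, hQ0, hQ, hQmin⟩ := exists_min_period hE ω hym
    obtain ⟨hpre, hloop, -, hin', hout'⟩ :=
      cornerOrbit_toggle_case1 hE hc₀ hagree hdiff hx hy hN hlt hP0 hP hPmin hQ0 hQ hQmin hi₁ hi₁N h₂'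
    have hNN : N' = N + Q := exitIndex_unique E _ _ _ _ hN' hlt' hout' hin'
    rw [hNN] at hN' hlt' ⊢
    have hagree' : ∀ e, e ≠ cTgt p → (e ∈ β ↔ e ∈ β') := fun e he => (hagree e he).symm
    have hdiff' : ¬ (cTgt p ∈ β ↔ cTgt p ∈ β') := fun h => hdiff h.symm
    have hi₁' : orb' i₁ = p := by rw [hpre i₁ le_rfl, hi₁]
    have hi₂' : orb' (i₁ + Q) = cornerPartner p := by
      have := hloop (Q - 1) (by omega)
      rwa [show i₁ + 1 + (Q - 1) = i₁ + Q by omega, Nat.sub_add_cancel hQ0, hQ] at this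
    have := pair_core (ω := ω') (ω' := ω) D hΩ hE hc₀ hagree' hdiff' hB hN' hlt' hN hlt hi₁' hi₂'
      (by omega) (by omega)
    linear_combination this

/-- **The pointwise pair identity** (registered helper of `stub_vertexRelation`; all cases). For
an admissible datum with Jordan carrier, an interior edge `e = cTgt p` (all faces at both
endpoints inner, no endpoint on the arc `B`) and two configurations whose completions agree off
`e` and differ at `e`, the spin-`1/3` vertex combinations of the four dart sums at `e` of the two
explorations cancel: `rel(ω) + rel(ω') = 0`. Cases: a dart of `ω` arrives at `e` through `p` or
through its partner (`pair_of_arrives`), or none does — then none does in `ω'` either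
(`cornerOrbit_toggle_case0`) and both combinations vanish (`rel_eq`).
[cite: DuminilCopinSmirnov2012Lattice, §8.3 Prop. 8.6] -/
theorem pair_rel_add_eq_zero :
    ∀ (D : DobrushinDomain) (E : DiscreteDobrushin), E.Ω = D.carrier → E.IsZdAdmissible →
      ∀ (ω ω' : BondConfig (Site 2)) (c₀ p : Site 2 × Fin 4), E.IsStartCorner c₀ →
        (∀ e, e ≠ cTgt p → (e ∈ E.bcBondConfig ω' ↔ e ∈ E.bcBondConfig ω)) →
        ¬ (cTgt p ∈ E.bcBondConfig ω' ↔ cTgt p ∈ E.bcBondConfig ω) →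
        (∀ x ∈ cTgt p, x ∉ E.zdArcB) → (∀ j, E.IsInnerFace (faceAt p.1 j)) →
        (∀ j, E.IsInnerFace (faceAt (p.1 + cornerUnit (p.2 + 1)) j)) →
          ∀ (N N' : ℕ), ¬ E.IsInnerFace (cFace (cornerOrbit (E.bcBondConfig ω) c₀ N)) →
            (∀ k < N, E.IsInnerFace (cFace (cornerOrbit (E.bcBondConfig ω) c₀ k))) →
            ¬ E.IsInnerFace (cFace (cornerOrbit (E.bcBondConfig ω') c₀ N')) →
            (∀ k < N', E.IsInnerFace (cFace (cornerOrbit (E.bcBondConfig ω') c₀ k))) →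
    ((∑ j ∈ Finset.filter (fun j => cornerOrbit (E.bcBondConfig ω) c₀ j = p) (Finset.range N),
          Complex.exp (((Real.pi / 6 : ℝ) : ℂ) * Complex.I) ^ (-(turnCount (E.bcBondConfig ω) c₀ j))) -
      (∑ j ∈ Finset.filter (fun j => cornerOrbit (E.bcBondConfig ω) c₀ j = cornerPartner p) (Finset.range N),
          Complex.exp (((Real.pi / 6 : ℝ) : ℂ) * Complex.I) ^ (-(turnCount (E.bcBondConfig ω) c₀ j))) -
      Complex.I * ((∑ j ∈ Finset.filter (fun j => cornerOrbit (E.bcBondConfig ω) c₀ j = (p.1, p.2 + 1)) (Finset.range N),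
          Complex.exp (((Real.pi / 6 : ℝ) : ℂ) * Complex.I) ^ (-(turnCount (E.bcBondConfig ω) c₀ j))) -
        (∑ j ∈ Finset.filter (fun j => cornerOrbit (E.bcBondConfig ω) c₀ j =
            ((cornerPartner p).1, (cornerPartner p).2 + 1)) (Finset.range N),
          Complex.exp (((Real.pi / 6 : ℝ) : ℂ) * Complex.I) ^ (-(turnCount (E.bcBondConfig ω) c₀ j))))) +
    ((∑ j ∈ Finset.filter (fun j => cornerOrbit (E.bcBondConfig ω') c₀ j = p) (Finset.range N'),
          Complex.exp (((Real.pi / 6 : ℝ) : ℂ) * Complex.I) ^ (-(turnCount (E.bcBondConfig ω') c₀ j))) -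
      (∑ j ∈ Finset.filter (fun j => cornerOrbit (E.bcBondConfig ω') c₀ j = cornerPartner p) (Finset.range N'),
          Complex.exp (((Real.pi / 6 : ℝ) : ℂ) * Complex.I) ^ (-(turnCount (E.bcBondConfig ω') c₀ j))) -
      Complex.I * ((∑ j ∈ Finset.filter (fun j => cornerOrbit (E.bcBondConfig ω') c₀ j = (p.1, p.2 + 1)) (Finset.range N'),
          Complex.exp (((Real.pi / 6 : ℝ) : ℂ) * Complex.I) ^ (-(turnCount (E.bcBondConfig ω') c₀ j))) -
        (∑ j ∈ Finset.filter (fun j => cornerOrbit (E.bcBondConfig ω') c₀ j =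
            ((cornerPartner p).1, (cornerPartner p).2 + 1)) (Finset.range N'),
          Complex.exp (((Real.pi / 6 : ℝ) : ℂ) * Complex.I) ^ (-(turnCount (E.bcBondConfig ω') c₀ j))))) = 0 := by
  intro D E hΩ hE ω ω' c₀ p hc₀ hagree hdiff hB hx hy N N' hN hlt hN' hlt'
  change rel[E.bcBondConfig ω, c₀, N, p] + rel[E.bcBondConfig ω', c₀, N', p] = 0
  have hagree2 : ∀ e, e ≠ cTgt (cornerPartner p) → (e ∈ E.bcBondConfig ω' ↔ e ∈ E.bcBondConfig ω) := by
    rw [cTgt_partner]; exact hagree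
  have hdiff2 : ¬ (cTgt (cornerPartner p) ∈ E.bcBondConfig ω' ↔ cTgt (cornerPartner p) ∈ E.bcBondConfig ω) := by
    rw [cTgt_partner]; exact hdiff
  have hB2 : ∀ x ∈ cTgt (cornerPartner p), x ∉ E.zdArcB := by rw [cTgt_partner]; exact hB
  by_cases h₁ : ∃ i₁, i₁ < N ∧ cornerOrbit (E.bcBondConfig ω) c₀ i₁ = p
  · obtain ⟨i₁, hi₁N, hi₁⟩ := h₁
    exact pair_of_arrives D hΩ hE hc₀ hagree hdiff hB hx hy hN hlt hN' hlt' hi₁ hi₁N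
  · by_cases h₂ : ∃ i₂, i₂ < N ∧ cornerOrbit (E.bcBondConfig ω) c₀ i₂ = cornerPartner p
    · obtain ⟨i₂, hi₂N, hi₂⟩ := h₂
      have hy' : ∀ j, E.IsInnerFace (faceAt ((cornerPartner p).1 + cornerUnit ((cornerPartner p).2 + 1)) j) := by
        rw [partner_fst_add]; exact hx
      have := pair_of_arrives (p := cornerPartner p) D hΩ hE hc₀ hagree2 hdiff2 hB2 hy hy' hN hlt hN' hlt' hi₂ hi₂N
      rw [rel_partner, rel_partner] at this
      linear_combination -this
    · -- no dart of `ω` arrives at `e`: neither does any dart of `ω'`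
      have h₁' : ∀ i < N, cornerOrbit (E.bcBondConfig ω) c₀ i ≠ p := fun i hi h => h₁ ⟨i, hi, h⟩
      have h₂' : ∀ i < N, cornerOrbit (E.bcBondConfig ω) c₀ i ≠ cornerPartner p := fun i hi h => h₂ ⟨i, hi, h⟩
      have hcase := cornerOrbit_toggle_case0 (c₀ := c₀) hagree hdiff h₁' h₂'
      have hNN : N' = N := exitIndex_unique E _ _ _ _ hN' hlt' (by rw [hcase N le_rfl]; exact hN)
        (fun k hk => by rw [hcase k hk.le]; exact hlt k hk)
      rw [hNN] at hN' hlt' ⊢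
      have z1 : ∀ r, (∀ i < N, cornerOrbit (E.bcBondConfig ω) c₀ i ≠ r) →
          dsum[E.bcBondConfig ω, c₀, N, r] = 0 ∧ dsum[E.bcBondConfig ω', c₀, N, r] = 0 := by
        intro r hr
        constructor <;> refine Finset.sum_eq_zero fun j hj => ?_ <;>
          rw [Finset.mem_filter, Finset.mem_range] at hj
        · exact absurd hj.2 (hr j hj.1)
        · rw [hcase j hj.1.le] at hj; exact absurd hj.2 (hr j hj.1)
      obtain ⟨r1, r2⟩ := rel_eq (p := p) hE hc₀ hN hlt hB
      obtain ⟨r1', r2'⟩ := rel_eq (p := p) (ω := ω') hE hc₀ hN' hlt' hB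
      by_cases he : cTgt p ∈ E.bcBondConfig ω
      · have he' : cTgt p ∉ E.bcBondConfig ω' := fun h => hdiff ⟨fun _ => he, fun _ => h⟩
        rw [r2 he, r1' he', (z1 p h₁').1, (z1 p h₁').2, (z1 _ h₂').1, (z1 _ h₂').2]
        ring
      · have he' : cTgt p ∈ E.bcBondConfig ω' := by
          by_contra h; exact hdiff ⟨fun h' => absurd h' h, fun h' => absurd h' he⟩
        rw [r1 he, r2' he', (z1 p h₁').1, (z1 p h₁').2, (z1 _ h₂').1, (z1 _ h₂').2]
        ring

end PairWrap

end Summit.CriticalPhenomena.CardyFormulaZ2.Cruxes.ParafermionPrecompact.KenyonStreamSecondRelation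

end
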